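import Mathlib
import HarnessLib
import Summits.HubbardSuperconductivity.HubbardSuperconductivity.Theorems.KLProgrammeKLRegimeEngineTwoLegCellReaderEffAction
import Summits.HubbardSuperconductivity.HubbardSuperconductivity.Theorems.KLProgrammeKLRegimeSplitTwoLegIncrementMomentsFromPosition

/-!
# Route `KLProgramme` — crux K3 ENGINE (stmt-HubbardSuperconductivity-20437 `KLRegimeEngineV17F2`), row (b), E1 docket item (2) «(E2)-CELL-READER», part 6:
# the reader at a BLOCK INCREMENT `Δ_k = 𝒱_{d(k+1)}[K] − 𝒱_{dk}[K]` (the born two-leg size of the (ℛ4) track) — structural hypotheses discharged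

Cell `gate-hubbard-kl`, seat hubbard-kl-k3c2-p3 (g19).  Sequel of `…EngineTwoLegCellReaderEffAction` (part 4, `T = 𝒱_i[K]`).  The in-tower production route for (E2)
(evidence `E2-CELL-READER.md` §6) runs a BORN two-leg track: the weighted pinned sizes of the increments `klTowerIncr L M β U μ K d k = 𝒱_{d(k+1)}[K] − 𝒱_{dk}[K]` at their born
family.  Kernels are linear (`TwoLegFourier.kernel_sub'`), so the `2`-kernel of `Δ_k` is conserving-diagonal with the DIFFERENCE of the two canonical symbols and its anomalous
strings vanish:

* `kernel_klTowerIncr_two_eq_ite_bar` (linearity: `TwoLegFourier.kernel_sub'`), `canonicalSymbol_klTowerIncr_anomalous`;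
* **`klWtPinnedSumOf_two_klTowerIncr_le`** — for every frame `K`, block data `(d, k)`, family `J`, pin `(q, w)`:
  `klWtPinnedSumOf L M β μ K J 2 (Δ_k) q w ≤ ε_x·Σ_{ℓ′} Σ_z w_J(z)·‖Σ_Q χ̄_Q(z)•(F_{J,ω}(Q̃)F_{J,ω′}(Q̃)·(Ŵ₂^{τ(q)}[𝒱_{d(k+1)}] − Ŵ₂^{τ(q)}[𝒱_{dk}])(Q̃))‖` — NO structural hypothesis;
  the data forms of parts 3/5 apply verbatim with `g` = the difference symbol.

Everything is proved; no definitions, no named facts; nothing here asserts (E2), any engine row, K3 or superconductivity. [folklore]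
References: BGM 2006 §2.3 (2.17), §2.8 (2.76), §3 (3.2)–(3.8) [cite: BenfattoGiulianiMastropietro2006].
-/

noncomputable section

namespace Summit.HubbardSuperconductivity.HubbardSuperconductivity.Theorems.TorusFourierL2

set_option linter.dupNamespace false -- summit = problem name (single-conjunct summit), D-0017

open Finset Complex Literature.Probability.LatticeModels Literature.MathematicalPhysics.QuantumLattice
open Literature.MathematicalPhysics.QuantumLattice.GrassmannAlgebra
open Summit.HubbardSuperconductivity.HubbardSuperconductivity.Theorems.KLRegimeSplit
open Summit.HubbardSuperconductivity.HubbardSuperconductivity.Theorems.KLProgrammeLegKernels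
open Summit.HubbardSuperconductivity.HubbardSuperconductivity.Theorems.EngineV8
open scoped Real ComplexConjugate

variable {L M : ℕ} [NeZero L] [NeZero M]

/-- **The `2`-kernel of a block increment is conserving-diagonal with the difference of the canonical symbols.** [cite: BenfattoGiulianiMastropietro2006, §2.3 (2.17)] -/
theorem kernel_klTowerIncr_two_eq_ite_bar (β U μ : ℝ) (K : TrigPolyC4v) (d k : ℕ) (τ : Fin 2 → Fin 2 × Fin 2) (kk : Fin 2 → FreqMomentum L M) :
    kernel ℂ (klTowerIncr L M β U μ K d k) 2 (fun j => ((kk j, (τ j).1), (τ j).2)) =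
      if ((fun _ : Fin 1 => (((kk 0).1 : ℕ) : ZMod (2 * M))), (kk 0).2) = (((fun _ : Fin 1 => (((kk 1).1 : ℕ) : ZMod (2 * M))), (kk 1).2) : TorusSite 1 (2 * M) × TorusSite 2 L)
      then (fun (τ : Fin 2 → Fin 2 × Fin 2) (Q : TorusSite 1 (2 * M) × TorusSite 2 L) =>
          kernel ℂ (klEffectiveAction L M β U μ K klE0 (d * (k + 1))) 2 (fun j => (((⟨(Q.1 0).val, ZMod.val_lt (Q.1 0)⟩, Q.2), (τ j).1), (τ j).2)) -
            kernel ℂ (klEffectiveAction L M β U μ K klE0 (d * k)) 2 (fun j => (((⟨(Q.1 0).val, ZMod.val_lt (Q.1 0)⟩, Q.2), (τ j).1), (τ j).2))) τ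
        ((fun _ : Fin 1 => (((kk 0).1 : ℕ) : ZMod (2 * M))), (kk 0).2) else 0 := by
  unfold klTowerIncr
  rw [TwoLegFourier.kernel_sub', kernel_klEffectiveAction_two_eq_ite_bar, kernel_klEffectiveAction_two_eq_ite_bar]
  split_ifs <;> simp

/-- The difference symbol vanishes on the anomalous strings. [cite: BenfattoGiulianiMastropietro2006, §2.3] -/
theorem canonicalSymbol_klTowerIncr_anomalous (β U μ : ℝ) (K : TrigPolyC4v) (d k : ℕ) (τ : Fin 2 → Fin 2 × Fin 2) (hc : (τ 0).2 = (τ 1).2) :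
    (fun (τ : Fin 2 → Fin 2 × Fin 2) (Q : TorusSite 1 (2 * M) × TorusSite 2 L) =>
        kernel ℂ (klEffectiveAction L M β U μ K klE0 (d * (k + 1))) 2 (fun j => (((⟨(Q.1 0).val, ZMod.val_lt (Q.1 0)⟩, Q.2), (τ j).1), (τ j).2)) -
          kernel ℂ (klEffectiveAction L M β U μ K klE0 (d * k)) 2 (fun j => (((⟨(Q.1 0).val, ZMod.val_lt (Q.1 0)⟩, Q.2), (τ j).1), (τ j).2))) τ = 0 := by
  funext Q
  simp only [Pi.zero_apply, kernel_klEffectiveAction_two_eq_zero_of_anomalous β U μ K _ τ hc, sub_zero]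

/-- **THE BORN TWO-LEG CELL OF A BLOCK INCREMENT, NO STRUCTURAL HYPOTHESIS**: for every frame `K`, block data `(d, k)`, family `J`, pin `(q, w)`,
`klWtPinnedSumOf L M β μ K J 2 (Δ_k) q w ≤ ε_x·Σ_{ℓ′} Σ_z w_J(z)·‖Σ_Q χ̄_Q(z)•(F_{J,ω}(Q̃)F_{J,ω′}(Q̃)·(Ŵ₂^{τ(q)}[𝒱_{d(k+1)}] − Ŵ₂^{τ(q)}[𝒱_{dk}])(Q̃))‖`.
[cite: BenfattoGiulianiMastropietro2006, §2.8 (2.76), (2.81), §3 (3.2)–(3.8)] -/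
theorem klWtPinnedSumOf_two_klTowerIncr_le {β : ℝ} (hβ : 0 < β) (U μ : ℝ) (K : TrigPolyC4v) (d k J : ℕ) (q : Fin 2)
    (w : SpaceTimeIdx L M × SectorLeg (sectorCount J)) :
    klWtPinnedSumOf L M β μ K J 2 (klTowerIncr L M β U μ K d k) q w ≤
      imagTimeWeight β M * ∑ ℓ' : SectorLeg (sectorCount J), ∑ z : TorusSite 1 (2 * M) × TorusSite 2 L,
        (1 + klScale klE0 J * β / (2 * M) * |(((z.1 0).valMinAbs : ℤ) : ℝ)| + klScale klE0 J * |(((z.2 0).valMinAbs : ℤ) : ℝ)| +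
            klScale klE0 J * |(((z.2 1).valMinAbs : ℤ) : ℝ)|) *
          ‖∑ Q : TorusSite 1 (2 * M) × TorusSite 2 L, (torusChar Q.1 z.1 * torusChar Q.2 z.2) •
            (klAnisoFamily L M β μ K klE0 J w.2.1.1 (⟨(Q.1 0).val, ZMod.val_lt (Q.1 0)⟩, Q.2) *
                klAnisoFamily L M β μ K klE0 J ℓ'.1.1 (⟨(Q.1 0).val, ZMod.val_lt (Q.1 0)⟩, Q.2) *
              (kernel ℂ (klEffectiveAction L M β U μ K klE0 (d * (k + 1))) 2
                  (fun j => (((⟨(Q.1 0).val, ZMod.val_lt (Q.1 0)⟩, Q.2), ((fun j : Fin 2 => if j = q then (w.2.1.2, w.2.2) else (ℓ'.1.2, ℓ'.2)) j).1),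
                    ((fun j : Fin 2 => if j = q then (w.2.1.2, w.2.2) else (ℓ'.1.2, ℓ'.2)) j).2)) -
                kernel ℂ (klEffectiveAction L M β U μ K klE0 (d * k)) 2
                  (fun j => (((⟨(Q.1 0).val, ZMod.val_lt (Q.1 0)⟩, Q.2), ((fun j : Fin 2 => if j = q then (w.2.1.2, w.2.2) else (ℓ'.1.2, ℓ'.2)) j).1),
                    ((fun j : Fin 2 => if j = q then (w.2.1.2, w.2.2) else (ℓ'.1.2, ℓ'.2)) j).2))))‖ :=
  klWtPinnedSumOf_two_le_sum_momentWt_charSum hβ μ K J (klTowerIncr L M β U μ K d k)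
    (fun (τ : Fin 2 → Fin 2 × Fin 2) (Q : TorusSite 1 (2 * M) × TorusSite 2 L) =>
        kernel ℂ (klEffectiveAction L M β U μ K klE0 (d * (k + 1))) 2 (fun j => (((⟨(Q.1 0).val, ZMod.val_lt (Q.1 0)⟩, Q.2), (τ j).1), (τ j).2)) -
          kernel ℂ (klEffectiveAction L M β U μ K klE0 (d * k)) 2 (fun j => (((⟨(Q.1 0).val, ZMod.val_lt (Q.1 0)⟩, Q.2), (τ j).1), (τ j).2)))
    (kernel_klTowerIncr_two_eq_ite_bar β U μ K d k) (canonicalSymbol_klTowerIncr_anomalous β U μ K d k) q w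

end Summit.HubbardSuperconductivity.HubbardSuperconductivity.Theorems.TorusFourierL2

end
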